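import Literature.Analysis.FluidPDE.TorusWordLeibniz
import HarnessLib

/-!
# `L²` bounds for the Leibniz expansion along words: the commutator `∂^w(aU) − a ∂^w U`

Analysis/FluidPDE support file (everything proved; no named facts), sequel of `TorusWordLeibniz`.
The commutator estimates of the energy method at arbitrary order (Majda 1984, Ch. 2 §2.1, proof of
Thm 2.2; Majda–Bertozzi 2002, Prop. 3.7) expand `∂^w(a U) − a ∂^w U` by the Leibniz formula into
the terms with at least one derivative on `a`, and bound them in `L²` with every factor but one in
the sup norm. This file provides:

* `lowerSplits w` — the `2^{|w|} − 1` splittings `(α, β)` of `w` with `α ≠ []`, defined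
  recursively, with `mem_lowerSplits` (lengths, `α ≠ []`);
* `wordDeriv_smul_eq_top_add_lower` — **the commutator expansion**
  `∂^w(a • U) = a • ∂^w U + ∑_{(α,β) ∈ lowerSplits w} ∂^α a • ∂^β U`;
* `integral_norm_sq_list_sum_le` — `∫ ‖∑_{p ∈ l} g_p‖² ≤ |l| ∑_{p ∈ l} ∫ ‖g_p‖²` for continuous
  `g_p`;
* `integral_sq_smul_le_left/right` — `∫ ‖φ • ψ‖² ≤ A² ∫ ‖ψ‖²` if `|φ| ≤ A`, `≤ B² ∫ φ²` if
  `‖ψ‖ ≤ B`;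
* `integral_norm_sq_commutator_le` — the resulting bound
  `∫ ‖∂^w(a • U) − a • ∂^w U‖² ≤ (2^{|w|} − 1) ∑_{(α,β) ∈ lowerSplits w} ∫ ‖∂^α a • ∂^β U‖²`.

## References

* A. Majda, *Compressible Fluid Flow and Systems of Conservation Laws in Several Space
  Variables*, Springer 1984, Ch. 2 §2.1, Prop. 2.1 and proof of Thm 2.2. [`Majda1984`]
-/

noncomputable section

open Set Function MeasureTheory
open scoped ContDiff

namespace Literature.Analysis.FluidPDE

namespace Torus

open FunctionSpaces FunctionSpaces.Torus

variable {d : Type*} [Fintype d] [DecidableEq d] {F : Type*} [NormedAddCommGroup F] [NormedSpace ℝ F]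

/-! ## The lower splittings and the commutator expansion -/

/-- The splittings `(α, β)` of `w` with `α ≠ []` (at least one letter on the first factor), defined
recursively: for `i :: w`, the new letter alone on the first factor, or the new letter added to
either side of a lower splitting of `w`. [folklore] -/
def lowerSplits : List d → List (List d × List d)
  | [] => []
  | i :: w => ([i], w) :: (lowerSplits w).flatMap fun p => [(i :: p.1, p.2), (p.1, i :: p.2)]

omit [Fintype d] [DecidableEq d] in
/-- No lower splittings of the empty word. [folklore] -/
@[simp] theorem lowerSplits_nil : lowerSplits ([] : List d) = [] := rfl

omit [Fintype d] [DecidableEq d] in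
/-- Lower splittings of `i :: w`. [folklore] -/
theorem lowerSplits_cons (i : d) (w : List d) :
    lowerSplits (i :: w) = ([i], w) :: (lowerSplits w).flatMap fun p => [(i :: p.1, p.2), (p.1, i :: p.2)] := rfl

omit [Fintype d] [DecidableEq d] in
/-- There are `2^{|w|} − 1` lower splittings. [folklore] -/
theorem length_lowerSplits_add_one : ∀ w : List d, (lowerSplits w).length + 1 = 2 ^ w.length
  | [] => rfl
  | i :: w => by
      rw [lowerSplits_cons, List.length_cons, List.length_flatMap, List.length_cons, pow_succ]
      have ih := length_lowerSplits_add_one w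
      simp only [List.length_cons, List.length_nil, List.map_const', List.sum_replicate, smul_eq_mul]
      omega

omit [Fintype d] [DecidableEq d] in
/-- Lower splittings: complementary lengths and a nonempty first part. [folklore] -/
theorem mem_lowerSplits : ∀ {w : List d} {p : List d × List d}, p ∈ lowerSplits w →
    p.1 ≠ [] ∧ p.1.length + p.2.length = w.length
  | [], p, hp => by simp at hp
  | i :: w, p, hp => by
      rw [lowerSplits_cons, List.mem_cons, List.mem_flatMap] at hp
      rcases hp with rfl | ⟨q, hq, hpq⟩
      · exact ⟨by simp, by simp [Nat.add_comm]⟩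
      · have ih := mem_lowerSplits hq
        simp only [List.mem_cons, List.mem_nil_iff, or_false] at hpq
        rcases hpq with rfl | rfl
        · simp only [ne_eq, reduceCtorEq, not_false_eq_true, List.length_cons, true_and]; omega
        · refine ⟨ih.1, ?_⟩
          simp only [List.length_cons]; omega

omit [Fintype d] [DecidableEq d] in
/-- Lower splittings: `1 ≤ |α| ≤ |w|` and `|β| ≤ |w| − 1`. [folklore] -/
theorem mem_lowerSplits_length {w : List d} {p : List d × List d} (hp : p ∈ lowerSplits w) :
    1 ≤ p.1.length ∧ p.1.length ≤ w.length ∧ p.2.length + 1 ≤ w.length := by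
  obtain ⟨h1, h2⟩ := mem_lowerSplits hp
  have h3 : 0 < p.1.length := List.length_pos_iff.2 h1
  omega

/-- **The commutator expansion along a word**: for smooth `a : 𝕋^d → ℝ`, `U : 𝕋^d → F`,
`∂^w(a • U) = a • ∂^w U + ∑_{(α,β) ∈ lowerSplits w} ∂^α a • ∂^β U`. [folklore] -/
theorem wordDeriv_smul_eq_top_add_lower {a : UnitAddTorus d → ℝ} {U : UnitAddTorus d → F} (ha : IsSmooth a)
    (hU : IsSmooth U) : ∀ w : List d, wordDeriv w (fun x => a x • U x) =
      (fun x => a x • wordDeriv w U x) + ((lowerSplits w).map fun p => fun x => wordDeriv p.1 a x • wordDeriv p.2 U x).sum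
  | [] => by simp
  | i :: w => by
      have ih := wordDeriv_smul_eq_top_add_lower ha hU w
      have hsm : ∀ p ∈ lowerSplits w, IsSmooth (fun x => wordDeriv p.1 a x • wordDeriv p.2 U x) := fun p _ =>
        (isSmooth_wordDeriv ha p.1).smul' (isSmooth_wordDeriv hU p.2)
      have htop : IsSmooth (fun x => a x • wordDeriv w U x) := ha.smul' (isSmooth_wordDeriv hU w)
      have hlow : IsSmooth ((lowerSplits w).map fun p => fun x => wordDeriv p.1 a x • wordDeriv p.2 U x).sum :=
        isSmooth_list_sum _ hsm
      rw [wordDeriv_cons, ih, partialDeriv_add (htop.isContDiff (by simp)) (hlow.isContDiff (by simp))]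
      -- the top term: product rule
      have e1 : Torus.partialDeriv i (fun x => a x • wordDeriv w U x) =
          (fun x => a x • wordDeriv (i :: w) U x) + fun x => wordDeriv [i] a x • wordDeriv w U x := by
        funext x
        rw [partialDeriv_smul (ha.isContDiff (n := 1) (by simp)) ((isSmooth_wordDeriv hU w).isContDiff (n := 1) (by simp))]
        rfl
      -- the lower terms: `∂ᵢ` through the list sum and the product rule termwise
      have e2 : Torus.partialDeriv i ((lowerSplits w).map fun p => fun x => wordDeriv p.1 a x • wordDeriv p.2 U x).sum =
          (((lowerSplits w).flatMap fun p => [(i :: p.1, p.2), (p.1, i :: p.2)]).map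
            fun p => fun x => wordDeriv p.1 a x • wordDeriv p.2 U x).sum := by
        have h1 := wordDeriv_list_sum (lowerSplits w) (g := fun p => fun x => wordDeriv p.1 a x • wordDeriv p.2 U x) hsm [i]
        simp only [wordDeriv_singleton] at h1
        rw [h1]
        clear h1 ih hlow hsm
        induction lowerSplits w with
        | nil => simp
        | cons p l ihl =>
            rw [List.map_cons, List.sum_cons, List.flatMap_cons, List.map_append, List.sum_append, ihl]
            congr 1
            simp only [List.map_cons, List.map_nil, List.sum_cons, List.sum_nil, add_zero, wordDeriv_cons]
            funext x
            rw [partialDeriv_smul ((isSmooth_wordDeriv ha p.1).isContDiff (n := 1) (by simp))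
              ((isSmooth_wordDeriv hU p.2).isContDiff (n := 1) (by simp)), add_comm, Pi.add_apply]
      rw [e1, e2, lowerSplits_cons, List.map_cons, List.sum_cons, add_assoc]

/-! ## Integral bounds -/

omit [DecidableEq d] [NormedSpace ℝ F] in
/-- `∫ ‖∑ₖ Gₖ‖² ≤ (#ι) ∑ₖ ∫ ‖Gₖ‖²` for a finite family of continuous functions on the torus. [folklore] -/
theorem integral_norm_sq_sum_le {ι : Type*} [Fintype ι] {G : ι → UnitAddTorus d → F} (hG : ∀ k, Continuous (G k)) :
    ∫ x, ‖∑ k, G k x‖ ^ 2 ≤ Fintype.card ι * ∑ k, ∫ x, ‖G k x‖ ^ 2 := by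
  have hpt : ∀ x, ‖∑ k, G k x‖ ^ 2 ≤ Fintype.card ι * ∑ k, ‖G k x‖ ^ 2 := fun x => by
    have h1 : ‖∑ k, G k x‖ ≤ ∑ k, ‖G k x‖ := norm_sum_le _ _
    have h2 : (∑ k, ‖G k x‖) ^ 2 ≤ Fintype.card ι * ∑ k, ‖G k x‖ ^ 2 := by
      have := sq_sum_le_card_mul_sum_sq (s := (Finset.univ : Finset ι)) (f := fun k => ‖G k x‖)
      simpa [Finset.card_univ] using this
    exact (pow_le_pow_left₀ (norm_nonneg _) h1 2).trans h2
  have ci : ∀ {f : UnitAddTorus d → ℝ}, Continuous f → Integrable f volume := fun hf =>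
    hf.integrable_of_hasCompactSupport (HasCompactSupport.of_compactSpace _)
  have hint : ∀ k, Integrable (fun x => ‖G k x‖ ^ 2) volume := fun k => ci ((hG k).norm.pow 2)
  calc ∫ x, ‖∑ k, G k x‖ ^ 2 ≤ ∫ x, Fintype.card ι * ∑ k, ‖G k x‖ ^ 2 :=
        integral_mono (ci ((continuous_finsetSum _ fun k _ => hG k).norm.pow 2))
          ((integrable_finsetSum _ fun k _ => hint k).const_mul _) hpt
    _ = Fintype.card ι * ∑ k, ∫ x, ‖G k x‖ ^ 2 := by
        rw [integral_const_mul, integral_finsetSum _ fun k _ => hint k]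

omit [Fintype d] [DecidableEq d] [NormedSpace ℝ F] in
/-- A `List` sum of functions as a sum over positions. [folklore] -/
theorem list_map_sum_eq_sum_fin {ι : Type*} (l : List ι) (g : ι → UnitAddTorus d → F) :
    (l.map g).sum = ∑ k : Fin l.length, g (l.get k) := by
  rw [← List.sum_ofFn]
  congr 1
  exact (List.ofFn_getElem_eq_map l g).symm

omit [DecidableEq d] [NormedSpace ℝ F] in
/-- `∫ ‖∑_{p ∈ l} g_p‖² ≤ |l| ∑_{k} ∫ ‖g_{l[k]}‖²` for a list of continuous functions. [folklore] -/
theorem integral_norm_sq_list_sum_le {ι : Type*} (l : List ι) {g : ι → UnitAddTorus d → F}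
    (hg : ∀ p ∈ l, Continuous (g p)) :
    ∫ x, ‖(l.map g).sum x‖ ^ 2 ≤ l.length * ∑ k : Fin l.length, ∫ x, ‖g (l.get k) x‖ ^ 2 := by
  rw [list_map_sum_eq_sum_fin]
  have h := integral_norm_sq_sum_le (G := fun k : Fin l.length => g (l.get k)) fun k => hg _ (List.get_mem l k)
  simp only [Fintype.card_fin, Finset.sum_apply] at h ⊢
  convert h using 2

omit [DecidableEq d] in
/-- `∫ ‖φ • ψ‖² ≤ A² ∫ ‖ψ‖²` when `|φ| ≤ A` (continuous `φ, ψ`). [folklore] -/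
theorem integral_norm_sq_smul_le_left {φ : UnitAddTorus d → ℝ} {ψ : UnitAddTorus d → F} (hφ : Continuous φ)
    (hψ : Continuous ψ) {A : ℝ} (hA : ∀ x, |φ x| ≤ A) :
    ∫ x, ‖φ x • ψ x‖ ^ 2 ≤ A ^ 2 * ∫ x, ‖ψ x‖ ^ 2 := by
  have ci : ∀ {f : UnitAddTorus d → ℝ}, Continuous f → Integrable f volume := fun hf =>
    hf.integrable_of_hasCompactSupport (HasCompactSupport.of_compactSpace _)
  rw [← integral_const_mul]
  refine integral_mono (ci ((hφ.smul hψ).norm.pow 2)) ((ci (hψ.norm.pow 2)).const_mul _) fun x => ?_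
  have h1 : ‖φ x • ψ x‖ ^ 2 = |φ x| ^ 2 * ‖ψ x‖ ^ 2 := by rw [norm_smul, Real.norm_eq_abs, mul_pow]
  rw [h1]
  exact mul_le_mul_of_nonneg_right (pow_le_pow_left₀ (abs_nonneg _) (hA x) 2) (sq_nonneg _)

omit [DecidableEq d] in
/-- `∫ ‖φ • ψ‖² ≤ B² ∫ φ²` when `‖ψ‖ ≤ B` (continuous `φ, ψ`). [folklore] -/
theorem integral_norm_sq_smul_le_right {φ : UnitAddTorus d → ℝ} {ψ : UnitAddTorus d → F} (hφ : Continuous φ)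
    (hψ : Continuous ψ) {B : ℝ} (hB : ∀ x, ‖ψ x‖ ≤ B) :
    ∫ x, ‖φ x • ψ x‖ ^ 2 ≤ B ^ 2 * ∫ x, φ x ^ 2 := by
  have ci : ∀ {f : UnitAddTorus d → ℝ}, Continuous f → Integrable f volume := fun hf =>
    hf.integrable_of_hasCompactSupport (HasCompactSupport.of_compactSpace _)
  rw [← integral_const_mul]
  refine integral_mono (ci ((hφ.smul hψ).norm.pow 2)) ((ci (hφ.pow 2)).const_mul _) fun x => ?_
  have h1 : ‖φ x • ψ x‖ ^ 2 = ‖ψ x‖ ^ 2 * φ x ^ 2 := by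
    rw [norm_smul, Real.norm_eq_abs, mul_pow, sq_abs, mul_comm]
  rw [h1]
  exact mul_le_mul_of_nonneg_right (pow_le_pow_left₀ (norm_nonneg _) (hB x) 2) (sq_nonneg _)

/-- **`L²` bound of the commutator `∂^w(a • U) − a • ∂^w U`**:
`∫ ‖∂^w(aU) − a ∂^w U‖² ≤ |lowerSplits w| ∑_{(α,β) ∈ lowerSplits w} ∫ ‖∂^α a • ∂^β U‖²` (sum over
positions). [cite: Majda1984, Ch. 2 §2.1, proof of Thm 2.2] -/
theorem integral_norm_sq_commutator_le {a : UnitAddTorus d → ℝ} {U : UnitAddTorus d → F} (ha : IsSmooth a)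
    (hU : IsSmooth U) (w : List d) :
    ∫ x, ‖wordDeriv w (fun y => a y • U y) x - a x • wordDeriv w U x‖ ^ 2 ≤
      (lowerSplits w).length * ∑ k : Fin (lowerSplits w).length,
        ∫ x, ‖wordDeriv ((lowerSplits w).get k).1 a x • wordDeriv ((lowerSplits w).get k).2 U x‖ ^ 2 := by
  have e : ∀ x, wordDeriv w (fun y => a y • U y) x - a x • wordDeriv w U x =
      ((lowerSplits w).map fun p => fun y => wordDeriv p.1 a y • wordDeriv p.2 U y).sum x := fun x => by
    rw [wordDeriv_smul_eq_top_add_lower ha hU w, Pi.add_apply, add_sub_cancel_left]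
  simp_rw [e]
  exact integral_norm_sq_list_sum_le (lowerSplits w)
    (g := fun p => fun y => wordDeriv p.1 a y • wordDeriv p.2 U y)
    fun p _ => ((isSmooth_wordDeriv ha p.1).smul' (isSmooth_wordDeriv hU p.2)).continuous

end Torus

end Literature.Analysis.FluidPDE

end
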